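import Literature.MathematicalPhysics.KineticTheory.ReyBelletThomas2002PosDensity
import HarnessLib

/-!
# Rey-Bellet–Thomas 2002, Theorem 2.1: the assembly from Theorem 3.10, irreducibility and Hörmander's theorem

Trunk T-KINETIC (Literature/MathematicalPhysics/KineticTheory). Inline decomposition step for the
named fact `ReyBelletThomas2002_thm21` (provefact unit), superseding the hypothesis `hlaw` ("`C^∞`
POSITIVE transition densities") of `ReyBelletThomas2002Thm21.lean`: the JOINT smoothness of the
transition densities is now DERIVED from Hörmander's theorem (`rb_jointDensity_of_hormander`,
`ReyBelletThomas2002JointDensity.lean`: forward AND backward equations, the latter from the time-reversal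
duality of the kernels), and the positivity of the invariant density is derived from
IRREDUCIBILITY alone (`rb_hasSmoothPosDensity_of_irreducible`, `ReyBelletThomas2002PosDensity.lean`:
duality again). After this file the named fact rests on exactly:

* **Hörmander 1967, Thm 1.1** (the named fact `Literature.Analysis.Distribution.Hormander1967_thm11`);
* **Theorem 3.10** of the paper (the Liapunov bound (39) for the constructed kernels; §3);
* **irreducibility** (Prop. 4.2 of the paper: every nonempty open set is charged from every point
  at some positive time; support theorem [27] + controllability [7, Thm 3.2]).

* `ReyBelletThomas2002_thm21_of_inputs_irreducible` (fixed data) and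
  `ReyBelletThomas2002_thm21_of_thm310_of_irreducible_of_hormander` — Theorem 2.1 from the three inputs.

## References

* L. Rey-Bellet, L. E. Thomas, Comm. Math. Phys. 225 (2002) 305–329, Thm 2.1, Thm 3.10, Props. 4.1–4.2, §5.
-/

noncomputable section

open MeasureTheory ProbabilityTheory Filter Topology Set Literature.Probability.Process
open scoped NNReal ENNReal BoundedContinuousFunction ContDiff

namespace Literature.MathematicalPhysics.KineticTheory.HeatConduction

open Literature.Analysis.Distribution (Hormander1967_thm11)

variable {N : ℕ}

/-- **Rey-Bellet–Thomas 2002, Theorem 2.1 for given chain data, from Theorem 3.10, irreducibility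
and Hörmander's theorem.** For `P = (U, V, γ)` with H1 (`2 ≤ k₁ ≤ k₂`), H2, `γ, Λ > 0`, `N ≥ 2`,
`T_L, T_R > 0`, assume for the CONSTRUCTED kernels `rbKernel`: Thm 3.10 as printed (`h310`) and
irreducibility (`hirr`); assume Hörmander 1967 Thm 1.1 (`hH`). Then the full conclusion of
Theorem 2.1 holds with the witness `S = rbSemigroup`: joint smooth transition densities
(`rb_jointDensity_of_hormander`), the minorisation from densities and irreducibility, the §5 assembly
(Krylov–Bogoliubov, Harris), the smooth invariant density and its positivity
(`rb_hasSmoothPosDensity_of_irreducible`). [cite: ReyBelletThomas2002, Thm 2.1] -/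
theorem ReyBelletThomas2002_thm21_of_inputs_irreducible (hH : Hormander1967_thm11)
    {P : OscillatorChain} {Λ k₁ k₂ : ℝ} (hk₁ : 2 ≤ k₁) (hk₁₂ : k₁ ≤ k₂)
    (hU : RBGrowth P.U k₁) (hV : RBGrowth P.V k₂) (hV2 : RBNondegenerate P.V) (hγ : 0 < P.γ)
    (hΛ : 0 < Λ) {N : ℕ} {T_L T_R : ℝ} (_hN : 2 ≤ N) (hL : 0 < T_L) (hR : 0 < T_R)
    (h310 : ∀ s : ℝ≥0, 0 < s → ∀ θ : ℝ, 0 < θ → θ < 1 / max T_L T_R →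
      ∃ (U : Set (RBPhaseSpace N)) (κ L : ℝ), IsCompact U ∧ κ < 1 ∧
        ∀ x, ∫⁻ y, ENNReal.ofReal (Real.exp (θ * P.rbEnergy N y)) ∂(P.rbKernel Λ N T_L T_R s x) ≤
          ENNReal.ofReal (κ * Real.exp (θ * P.rbEnergy N x) + L * U.indicator 1 x))
    (hirr : ∀ (z : RBPhaseSpace N) (U : Set (RBPhaseSpace N)), IsOpen U → U.Nonempty →
      ∃ t : ℝ≥0, 0 < t ∧ 0 < P.rbKernel Λ N T_L T_R t z U) :
    ∃ S : MarkovSemigroupFor (P.rbGenerator Λ N T_L T_R),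
      (∃ p : ℝ → RBPhaseSpace N → RBPhaseSpace N → ℝ,
        ContDiffOn ℝ ∞ (fun w : ℝ × RBPhaseSpace N × RBPhaseSpace N => p w.1 w.2.1 w.2.2)
          (Set.Ioi (0 : ℝ) ×ˢ Set.univ) ∧
        ∀ t : ℝ≥0, 0 < t → ∀ x : RBPhaseSpace N,
          S.kernel t x = (volume : Measure (RBPhaseSpace N)).withDensity
            fun y => ENNReal.ofReal (p t x y)) ∧
      ∃ μ : Measure (RBPhaseSpace N), IsProbabilityMeasure μ ∧ S.IsInvariant μ ∧
        (∀ ν : Measure (RBPhaseSpace N), IsProbabilityMeasure ν → S.IsInvariant ν → ν = μ) ∧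
        HasSmoothPosDensity μ ∧
        ∀ θ : ℝ, 0 < θ → θ < 1 / max T_L T_R →
          Integrable (fun y => Real.exp (θ * P.rbEnergy N y)) μ ∧
          (∀ (t : ℝ≥0) (x : RBPhaseSpace N),
            Integrable (fun y => Real.exp (θ * P.rbEnergy N y)) (S.kernel t x)) ∧
          ∃ r R : ℝ, 1 < r ∧ 0 ≤ R ∧
            (∀ (x : RBPhaseSpace N) (t : ℝ≥0) (f : RBPhaseSpace N → ℝ), Measurable f →
              (∀ y, |f y| ≤ Real.exp (θ * P.rbEnergy N y)) →
              |S.act t f x - ∫ y, f y ∂μ| ≤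
                R * r ^ (-(t : ℝ)) * Real.exp (θ * P.rbEnergy N x)) ∧
            (∀ (t : ℝ≥0) (f g : RBPhaseSpace N → ℝ) (a b : ℝ), 0 < (t : ℝ) →
              Measurable f → Measurable g →
              (∀ y, f y ^ 2 ≤ a * Real.exp (θ * P.rbEnergy N y)) →
              (∀ y, g y ^ 2 ≤ b * Real.exp (θ * P.rbEnergy N y)) →
              |∫ y, g y * S.act t f y ∂μ - (∫ y, f y ∂μ) * ∫ y, g y ∂μ| ≤
                R * r ^ (-(t : ℝ)) * Real.sqrt a * Real.sqrt b) := by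
  have hk1 : 1 ≤ k₁ := by linarith
  have hk2 : 1 ≤ k₂ := by linarith
  set S := P.rbSemigroup hU hV hk1 hk2 hγ.le Λ N T_L T_R hL.le hR.le with hS
  have hSk : ∀ t, S.kernel t = P.rbKernel Λ N T_L T_R t := fun t => rfl
  -- the joint smooth densities, from Hörmander's theorem
  obtain ⟨p, hp, hp0, hdens⟩ :=
    OscillatorChain.rb_jointDensity_of_hormander hU hV hk1 hk2 hγ Λ hL hR (T_L := T_L) (T_R := T_R) hH hV2 hΛ.ne'
  have hdens' : ∀ t : ℝ≥0, 0 < t → ∀ x : RBPhaseSpace N,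
      S.kernel t x = (volume : Measure (RBPhaseSpace N)).withDensity fun y => ENNReal.ofReal (p t x y) :=
    fun t ht x => hdens t ht x
  refine ⟨S, ⟨p, hp, hdens'⟩, ?_⟩
  -- the inputs of the §5 assembly
  have hUc : Continuous P.U := hU.continuous
  have hVc : Continuous P.V := hV.continuous
  have hcpt : ∀ E : ℝ, IsCompact {x : RBPhaseSpace N | P.rbEnergy N x ≤ E} :=
    P.isCompact_setOf_rbEnergy_le hU hV hk1 hk2 N
  have hFeller : ∀ (t : ℝ≥0) (g : RBPhaseSpace N →ᵇ ℝ), Continuous (S.act t g) :=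
    OscillatorChain.continuous_act_rbSemigroup hU hV hk1 hk2 hγ.le Λ N hL.le hR.le
  have h26 := S.rb_h26 hU hV hk1 hk2 hγ.le hL hR
  have h310' : ∀ s : ℝ≥0, 0 < s → ∀ θ : ℝ, 0 < θ → θ < 1 / max T_L T_R →
      ∃ (U : Set (RBPhaseSpace N)) (κ L : ℝ), IsCompact U ∧ κ < 1 ∧
        ∀ x, ∫⁻ y, ENNReal.ofReal (Real.exp (θ * P.rbEnergy N y)) ∂(S.kernel s x) ≤
          ENNReal.ofReal (κ * Real.exp (θ * P.rbEnergy N x) + L * U.indicator 1 x) := h310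
  have h39 := S.rb_h39_of_thm310 h310'
  have hirr' : ∀ (z : RBPhaseSpace N) (U : Set (RBPhaseSpace N)), IsOpen U → U.Nonempty →
      ∃ t : ℝ≥0, 0 < S.kernel t z U := fun z U hUo hne => by
    obtain ⟨t, -, ht⟩ := hirr z U hUo hne
    exact ⟨t, ht⟩
  have hirrS : ∀ (z : RBPhaseSpace N) (U : Set (RBPhaseSpace N)), IsOpen U → U.Nonempty →
      ∃ t : ℝ≥0, 0 < t ∧ 0 < S.kernel t z U := hirr
  have hsmall := S.rb_minorization_of_density_of_irreducible hFeller ⟨p, hp.continuousOn, hdens'⟩ hirr'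
  obtain ⟨μ, hμ, hinv, huniq, hθ⟩ :=
    ReyBelletThomas2002_thm21_ergodic_of_inputs hUc hVc hγ.le hL hR hcpt S hFeller h26 h39 hsmall
  haveI := hμ
  obtain ⟨g, hg, -, hμg⟩ :=
    ReyBelletThomas2002_smoothDensity_of_hormander hH hU.1 hV.1 hV2 hγ hΛ.ne' hL hR S hinv
  have hposμ : HasSmoothPosDensity μ :=
    OscillatorChain.rb_hasSmoothPosDensity_of_irreducible hU hV hk1 hk2 hγ.le Λ T_L T_R S hSk
      hp.continuousOn hp0 hdens' hirrS hinv hg hμg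
  exact ⟨μ, hμ, hinv, huniq, hposμ, hθ⟩

/-- **Rey-Bellet–Thomas 2002, Theorem 2.1 (`ReyBelletThomas2002_thm21`) from Theorem 3.10,
irreducibility of the constructed process, and Hörmander's theorem.** After this file the named
fact rests on exactly: RBT Thm 3.10 (the Liapunov bound (39) for the constructed kernels — §3 of the
paper), irreducibility (Prop. 4.2: the support theorem and controllability), and Hörmander 1967
Thm 1.1. [cite: ReyBelletThomas2002, Thm 2.1] -/
theorem ReyBelletThomas2002_thm21_of_thm310_of_irreducible_of_hormander (hH : Hormander1967_thm11)
    (h310 : ∀ (P : OscillatorChain) (Λ : ℝ) (k₁ k₂ : ℝ), 2 ≤ k₁ → k₁ ≤ k₂ →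
      RBGrowth P.U k₁ → RBGrowth P.V k₂ → RBNondegenerate P.V → 0 < P.γ → 0 < Λ →
      ∀ (N : ℕ) (T_L T_R : ℝ), 2 ≤ N → 0 < T_L → 0 < T_R →
        ∀ s : ℝ≥0, 0 < s → ∀ θ : ℝ, 0 < θ → θ < 1 / max T_L T_R →
          ∃ (U : Set (RBPhaseSpace N)) (κ L : ℝ), IsCompact U ∧ κ < 1 ∧
            ∀ x, ∫⁻ y, ENNReal.ofReal (Real.exp (θ * P.rbEnergy N y)) ∂(P.rbKernel Λ N T_L T_R s x) ≤
              ENNReal.ofReal (κ * Real.exp (θ * P.rbEnergy N x) + L * U.indicator 1 x))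
    (hirr : ∀ (P : OscillatorChain) (Λ : ℝ) (k₁ k₂ : ℝ), 2 ≤ k₁ → k₁ ≤ k₂ →
      RBGrowth P.U k₁ → RBGrowth P.V k₂ → RBNondegenerate P.V → 0 < P.γ → 0 < Λ →
      ∀ (N : ℕ) (T_L T_R : ℝ), 2 ≤ N → 0 < T_L → 0 < T_R →
        ∀ (z : RBPhaseSpace N) (U : Set (RBPhaseSpace N)), IsOpen U → U.Nonempty →
          ∃ t : ℝ≥0, 0 < t ∧ 0 < P.rbKernel Λ N T_L T_R t z U) :
    ReyBelletThomas2002_thm21 := by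
  intro P Λ k₁ k₂ hk₁ hk₁₂ hU hV hV2 hγ hΛ N T_L T_R hN hL hR
  exact ReyBelletThomas2002_thm21_of_inputs_irreducible hH hk₁ hk₁₂ hU hV hV2 hγ hΛ hN hL hR
    (h310 P Λ k₁ k₂ hk₁ hk₁₂ hU hV hV2 hγ hΛ N T_L T_R hN hL hR)
    (hirr P Λ k₁ k₂ hk₁ hk₁₂ hU hV hV2 hγ hΛ N T_L T_R hN hL hR)

end Literature.MathematicalPhysics.KineticTheory.HeatConduction
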